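import Summits.RiemannHypothesis.RiemannHypothesis.Theorems.OddSectorOddOneSignedWindowsTwoLevelProximity
import Summits.RiemannHypothesis.RiemannHypothesis.Theorems.GroundBartaPolarPerronFrobeniusEvenSectorEulerLagrange
import HarnessLib

/-!
# Two-level proximity for EVEN-sector Weil ground states
(crux `EvenSectorBarta.EvenOneSignedWindows`, item stmt-RiemannHypothesis-19953; route F8 / hand-off H13 (s2) of the rh-explicit
HANDOFF track, `IDEAS-finite-rank.md` PART G7; RH-free)

The even twin of `OddSector.twoLevelProximity` (`OddSectorOddOneSignedWindowsTwoLevelProximity.lean`): if `u` is an operator-free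
EVEN-sector ground state of Weil's windowed form at `a` (`IsWeilEvenGroundState a u`, energy `ε_ev(a) = weilEvenGroundEnergy a`) and every
`L²`-normalised smooth even window test `h` orthogonal to `u` has `Re Q(h) ≥ m₂ > ε_ev(a)` (a lower bound below the SECOND even level),
then every normalised smooth even window test `v` satisfies

  `1 − |⟨u, v⟩|² ≤ (Re Q(v) − ε_ev(a)) / (m₂ − ε_ev(a))`.

This is the inequality behind step (s2) «L²-PROXIMITY from level data» of route F8 (`OneSignedWindow (7/20)` by an L²-source certificate):
with `v = u_N` a certified near-minimiser (`Re Q(u_N) ≤ ε_N`) and a certified `ε^{low} ≤ ε_ev(a)`, `β ≤ m₂`, it gives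
`1 − |⟨u, u_N⟩|² ≤ (ε_N − ε^{low})/(β − ε^{low})`, hence `‖u − u_N‖₂² = 2(1 − Re⟨u, u_N⟩)` small after fixing the phase of `u`.
Proof = the odd file's, verbatim, along the even minimising sequence with the even weak Euler–Lagrange identity
(`IsWeilEvenGroundState.exists_eulerLagrange_even`; the identity is only needed against EVEN tests, and `v` is even); the sector-free
bookkeeping lemmas `re_weilQuadratic_add_const_mul` and `twoLevel_limit` are reused from the odd file.
Nothing here bears on RH; one window's sign has no bearing on RH (G6-2 of the track's IDEAS-finite-rank.md).

References: M. Reed, B. Simon, *Methods of Modern Mathematical Physics IV*, Thm XIII.1–XIII.2 (min–max); E. Bombieri, Rend. Mat. Acc.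
Lincei (9) 11 (2000), §4 Lemma 1 / (4.2), Thm 3, Thm 5, §9 Lemma 11 (`Bombieri2000Weil`).
-/

noncomputable section

set_option linter.dupNamespace false

open Complex Filter Set MeasureTheory
open scoped Real Topology ComplexConjugate

namespace Summit.RiemannHypothesis.RiemannHypothesis.Theorems.PolarPerronFrobenius

open Literature.NumberTheory.LFunctions
open Literature.NumberTheory.LFunctions.ConnesVanSuijlekom
open Summit.RiemannHypothesis.RiemannHypothesis.Theorems.GroundStatesConvergeToXi
open Summit.RiemannHypothesis.RiemannHypothesis.Theorems.OddSector (re_weilQuadratic_add_const_mul twoLevel_limit)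

/-- **Un-normalised second EVEN level.** If `m₂ ≤ Re Q(h)` for every `L²`-normalised even window test `h` with `∫ h ū = 0`, then
`m₂ ∫|w|² ≤ Re Q(w)` for every even window test `w` with `∫ w ū = 0` (homogeneity; `ConnesVanSuijlekom.mul_integral_le_re_of_sphere`). [folklore] -/
theorem even_mul_integral_norm_sq_le_re_of_orthogonal {a m₂ : ℝ} {u w : ℝ → ℂ}
    (H : ∀ h : ℝ → ℂ, IsWeilTest h → tsupport h ⊆ Icc (-a) a → (∀ t, h (-t) = h t) →
      ∫ t, ‖h t‖ ^ 2 = (1 : ℝ) → ∫ t, h t * conj (u t) = 0 → m₂ ≤ (weilQuadratic h).re)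
    (hw : IsWeilTest w) (hws : tsupport w ⊆ Icc (-a) a) (hwe : ∀ t, w (-t) = w t)
    (horth : ∫ t, w t * conj (u t) = 0) :
    m₂ * ∫ t, ‖w t‖ ^ 2 ≤ (weilQuadratic w).re := by
  refine mul_integral_le_re_of_sphere hw fun c _ hnorm => ?_
  refine H _ (hw.const_mul c) (tsupport_mul_subset_right.trans hws) (fun t => ?_) hnorm ?_
  · simp only [hwe]
  · show ∫ t, (c : ℂ) * w t * conj (u t) = 0
    have e : (fun t => (c : ℂ) * w t * conj (u t)) = fun t => (c : ℂ) * (w t * conj (u t)) := by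
      funext t
      ring
    rw [e, integral_const_mul, horth, mul_zero]

/-- **Two-level proximity for an EVEN-sector ground state** (pairing `∫ v ū`). Let `u` be an even-sector ground state at window `a`
(`ε_ev = weilEvenGroundEnergy a`) and `m₂ > ε_ev` a lower bound for `Re Q` on the `L²`-normalised smooth even window tests orthogonal to `u`.
Then every normalised smooth even window test `v` satisfies `1 − |∫ v ū|² ≤ (Re Q(v) − ε_ev)/(m₂ − ε_ev)`. Proof: along the even minimising
sequence `gₙ → u` with the even weak Euler–Lagrange identity, the even tests `wₙ = v − (p/cₙ) gₙ` (`p = ∫ v ū`, `cₙ = ∫ gₙ ū → 1`) are exactly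
orthogonal to `u`; expand `Re Q(wₙ) ≥ m₂ ∫|wₙ|²` by polarisation and let `n → ∞` (`OddSector.twoLevel_limit`).
[cite: Bombieri2000Weil, §4 Lemma 1 / (4.2), Thm 3, Thm 5 and §9 Lemma 11] -/
theorem evenTwoLevelProximity {a : ℝ} {u : ℝ → ℂ} (hu : IsWeilEvenGroundState a u) {m₂ : ℝ}
    (hm : weilEvenGroundEnergy a < m₂)
    (H : ∀ h : ℝ → ℂ, IsWeilTest h → tsupport h ⊆ Icc (-a) a → (∀ t, h (-t) = h t) →
      ∫ t, ‖h t‖ ^ 2 = (1 : ℝ) → ∫ t, h t * conj (u t) = 0 → m₂ ≤ (weilQuadratic h).re)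
    {v : ℝ → ℂ} (hv : IsWeilTest v) (hvs : tsupport v ⊆ Icc (-a) a) (hve : ∀ t, v (-t) = v t)
    (hv1 : ∫ t, ‖v t‖ ^ 2 = (1 : ℝ)) :
    1 - ‖∫ t, v t * conj (u t)‖ ^ 2 ≤
      ((weilQuadratic v).re - weilEvenGroundEnergy a) / (m₂ - weilEvenGroundEnergy a) := by
  obtain ⟨g, hg, hQ, hL, hEL⟩ := hu.exists_eulerLagrange_even
  have hum : MemLp u 2 := hu.memLp
  have hvm : MemLp v 2 := isWeilTest_memLp hv
  have hgm : ∀ n, MemLp (g n) 2 := fun n => isWeilTest_memLp (hg n).1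
  -- `cₙ = ⟨gₙ, u⟩ → ⟨u, u⟩ = 1`
  have hc1 : Tendsto (fun n => ∫ t, g n t * conj (u t)) atTop (𝓝 1) := by
    have h1 := tendsto_integral_mul_conj_left hum hum hgm hL
    rw [integral_mul_conj_self u, hu.integral_norm_sq, Complex.ofReal_one] at h1
    exact h1
  set p : ℂ := ∫ t, v t * conj (u t) with hp
  set c : ℕ → ℂ := fun n => ∫ t, g n t * conj (u t) with hc
  -- `⟨v, gₙ⟩ → ⟨v, u⟩ = p`
  have hPp : Tendsto (fun n => ∫ t, v t * conj (g n t)) atTop (𝓝 p) :=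
    tendsto_integral_mul_conj hvm hum hgm hL
  -- `W(gₙ ⋆ ṽ) → ε_ev ∫ u v̄ = ε_ev p̄` (even weak Euler–Lagrange, `v` even)
  have hconjp : ∫ t, u t * conj (v t) = conj p := by
    rw [hp, ← integral_conj]
    refine integral_congr_ae (Eventually.of_forall fun t => ?_)
    simp only [map_mul, Complex.conj_conj]
    exact mul_comm _ _
  have hAp : Tendsto (fun n => weilFunctional (weilConv (g n) (weilReflect v))) atTop
      (𝓝 ((weilEvenGroundEnergy a : ℂ) * conj p)) := by
    rw [← hconjp]
    exact hEL v hv hvs hve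
  -- `μₙ = -p / cₙ → -p`
  have hμ : Tendsto (fun n => -(p / c n)) atTop (𝓝 (-p)) := by
    have h1 : Tendsto (fun n => p / c n) atTop (𝓝 (p / 1)) :=
      Filter.Tendsto.div tendsto_const_nhds hc1 one_ne_zero
    rw [div_one] at h1
    exact h1.neg
  -- the second level applied to `wₙ = v + μₙ gₙ ⊥ u` (an EVEN test), expanded by polarisation
  have hstep : ∀ᶠ n in atTop,
      m₂ * (1 + ‖-(p / c n)‖ ^ 2 + 2 * (conj (-(p / c n)) * ∫ t, v t * conj (g n t)).re) ≤
        (weilQuadratic v).re + ‖-(p / c n)‖ ^ 2 * (weilQuadratic (g n)).re +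
          2 * (-(p / c n) * weilFunctional (weilConv (g n) (weilReflect v))).re := by
    filter_upwards [hc1.eventually_ne one_ne_zero] with n hn
    have hwt : IsWeilTest (v + fun t => -(p / c n) * g n t) := hv.add ((hg n).1.const_mul _)
    have hws : tsupport (v + fun t => -(p / c n) * g n t) ⊆ Icc (-a) a :=
      (tsupport_add _ _).trans (union_subset hvs (tsupport_mul_subset_right.trans (hg n).2.1))
    have hwe : ∀ t, (v + fun t => -(p / c n) * g n t) (-t) =
        (v + fun t => -(p / c n) * g n t) t := fun t => by
      simp only [Pi.add_apply, hve, (hg n).2.2.1]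
    have horth : ∫ t, (v + fun t => -(p / c n) * g n t) t * conj (u t) = 0 := by
      have e1 : (fun t => (v + fun t => -(p / c n) * g n t) t * conj (u t)) =
          fun t => v t * conj (u t) + -(p / c n) * (g n t * conj (u t)) := by
        funext t
        simp only [Pi.add_apply]
        ring
      have i1 : Integrable fun t => v t * conj (u t) := hvm.integrable_mul (memLp_conj hum)
      have i2 : Integrable fun t => -(p / c n) * (g n t * conj (u t)) :=
        ((hgm n).integrable_mul (memLp_conj hum)).const_mul (-(p / c n))
      rw [e1, integral_add i1 i2, integral_const_mul]
      change p + -(p / c n) * c n = 0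
      rw [neg_mul, div_mul_cancel₀ p hn, add_neg_cancel]
    have h1 := even_mul_integral_norm_sq_le_re_of_orthogonal H hwt hws hwe horth
    rw [re_weilQuadratic_add_const_mul hv (hg n).1 (-(p / c n))] at h1
    have e2 : ∫ t, ‖(v + fun t => -(p / c n) * g n t) t‖ ^ 2 =
        1 + ‖-(p / c n)‖ ^ 2 + 2 * (conj (-(p / c n)) * ∫ t, v t * conj (g n t)).re := by
      have h2 := integral_norm_sq_add_mul hvm (hgm n) (-(p / c n))
      rw [hv1, (hg n).2.2.2, mul_one, Complex.normSq_eq_norm_sq] at h2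
      simpa only [Pi.add_apply] using h2
    rw [e2] at h1
    exact h1
  rw [le_div_iff₀ (sub_pos.2 hm), mul_comm]
  exact twoLevel_limit hμ hAp hPp hQ hstep

/-- **The `L²`-distance form** (what step (s2) of route F8 consumes). Under the hypotheses of `evenTwoLevelProximity`, if moreover the
pairing `∫ v ū` is REAL and NON-NEGATIVE (fix the free phase of `u` by `IsWeilEvenGroundState.const_mul`), then
`∫ |v − u|² ≤ 2 (Re Q(v) − ε_ev)/(m₂ − ε_ev)`: indeed `∫|v − u|² = 2 − 2 Re⟨v,u⟩ = 2(1 − x)` with `x = ⟨v,u⟩ ∈ [0, 1]` and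
`1 − x ≤ 1 − x²`. [cite: Bombieri2000Weil, §4 Thm 3 (minimising sequences converge in L²); this track, IDEAS-finite-rank.md G7-1 (4)] -/
theorem integral_norm_sq_sub_le_of_evenTwoLevelProximity {a : ℝ} {u : ℝ → ℂ} (hu : IsWeilEvenGroundState a u) {m₂ : ℝ}
    (hm : weilEvenGroundEnergy a < m₂)
    (H : ∀ h : ℝ → ℂ, IsWeilTest h → tsupport h ⊆ Icc (-a) a → (∀ t, h (-t) = h t) →
      ∫ t, ‖h t‖ ^ 2 = (1 : ℝ) → ∫ t, h t * conj (u t) = 0 → m₂ ≤ (weilQuadratic h).re)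
    {v : ℝ → ℂ} (hv : IsWeilTest v) (hvs : tsupport v ⊆ Icc (-a) a) (hve : ∀ t, v (-t) = v t)
    (hv1 : ∫ t, ‖v t‖ ^ 2 = (1 : ℝ)) (hreal : (∫ t, v t * conj (u t)).im = 0) (hpos : 0 ≤ (∫ t, v t * conj (u t)).re) :
    ∫ t, ‖v t - u t‖ ^ 2 ≤ 2 * (((weilQuadratic v).re - weilEvenGroundEnergy a) / (m₂ - weilEvenGroundEnergy a)) := by
  have hprox := evenTwoLevelProximity hu hm H hv hvs hve hv1
  have hum : MemLp u 2 := hu.memLp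
  have hvm : MemLp v 2 := isWeilTest_memLp hv
  have h0 : 0 ≤ ((weilQuadratic v).re - weilEvenGroundEnergy a) / (m₂ - weilEvenGroundEnergy a) := by
    refine div_nonneg ?_ (sub_pos.2 hm).le
    have := hu.weilEvenGroundEnergy_le hv hvs hve hv1
    linarith
  -- `∫|v − u|² = 2 − 2 Re⟨v, u⟩`
  have h2 := integral_norm_sq_add_mul hvm hum (-1)
  rw [hv1, hu.integral_norm_sq, Complex.normSq_eq_norm_sq] at h2
  have hexp : ∫ t, ‖v t - u t‖ ^ 2 = 2 - 2 * (∫ t, v t * conj (u t)).re := by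
    have e : (fun t => ‖v t - u t‖ ^ 2) = fun t => ‖v t + -1 * u t‖ ^ 2 := by
      funext t
      congr 2
      ring
    rw [e, h2]
    simp only [norm_neg, norm_one, one_pow, mul_one, map_neg, map_one, neg_one_mul, Complex.neg_re]
    ring
  -- `‖⟨v,u⟩‖ = Re⟨v,u⟩ =: x ≥ 0`
  set P : ℂ := ∫ t, v t * conj (u t) with hP
  have hnorm : ‖P‖ = P.re := by
    have e : P = ((P.re : ℝ) : ℂ) := Complex.ext (by simp) (by simp [hreal])
    rw [e, Complex.norm_real, Real.norm_of_nonneg hpos, Complex.ofReal_re]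
  rw [hnorm] at hprox
  rw [hexp]
  rcases le_or_gt P.re 1 with hx1 | hx1
  · nlinarith [hprox, hpos, hx1]
  · nlinarith [h0, hx1]

end Summit.RiemannHypothesis.RiemannHypothesis.Theorems.PolarPerronFrobenius
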